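import Summits.BirchSwinnertonDyer.Rank1Residual.PrintCfram.SplitPlaceTorsionZpThree
import Summits.BirchSwinnertonDyer.Rank1Residual.X12.O11.RamifiedEllipticUnitMechanismZpThreeT
import HarnessLib

/-!
# Route `PrintCFram`: regime T `LocalThreeTorsionBSDThree` (item stmt-BirchSwinnertonDyer-20699) and
# the whole `@3` crux C1 `CMRamifiedThreeBSD` (stmt-…-20371) BY NAME from ONE torsion-allowing law —
# (R-EU)₃ᵀ, equivalently the `ℤ₃`-level pair (IMC)₃ᴬᴸᴸ ∧ (PR|IMC)₃ᵀ — plus the local-kernel finiteness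
# obligation (cell `bsd-print-cfram`, D-0131 (2) print tier, seat ty2 gen 3 = the cell's
# discharge-interface typer; PLAN v5 ask (δ)(iv) «curve-level `localThreeTorsionBSDThree_of_indexLawAtThreeT`»)

HONEST FRAMING (cell `bsd-print-cfram`, HOME `run/shared/lean/pub/bsd-print-cfram/`): THEOREMS ONLY
(no definition, no named fact, no axiom, no `sorry`); nothing about BSD is booked; regimes N, V, T, the
crux C1 and the leaf `Summit.BirchSwinnertonDyer.WAllCornerFRamifiedAtThree` stay OPEN; 0 cells move;
beyond-print theorem: NO. (`Theorems/` is prover-only for a literature-prover seat, hence this folder.)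

CONTENT (class-wide hypotheses, all UNFOLDED — no route item body is named, D5.1-safe):
* `hfin : ∀ W, X12.O11.LocalKernelFiniteAtThree W` — the local-kernel finiteness obligation (p3's);
* `hT3 : ∀ W, HasCM → r_an = 1 → CMRamified W 3 → X12.O11.RamifiedCMEllipticUnitIndexAtThreeT W` —
  the class-wide torsion-allowing index law (R-EU)₃ᵀ (ty2 gen 3, companion VII-b); or, one level down,
* `h1 : ∀ W, … → X12.O11.RamifiedCMEllipticUnitIMCAtZpThreeAll W` and
  `h2 : GZK → ∀ W, … → X12.O11.RamifiedCMBottomClassIndexLawAtZpThreeT W` (the `ℤ₃`-level pair).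
Then, BY NAME:
* §1 `localThreeTorsionBSDThree_of_indexLawAtThreeT` : **T** `Theses.PrintCFram.LocalThreeTorsionBSDThree`
  (its `ℚ₃`-torsion witness binder is not even used: companion VII-c's consumer works at every
  rank-one `3`-frame); `splitPlaceTorsionBSDThree_of_indexLawAtThreeT` : **V** and
  `torsionFreeFrameBSDThree_of_indexLawAtThreeT` : **N** (through (R-EU)₃ᵀ ⟹ (R-EU)₃ᵛ, companion
  VII-c, and p554137's edges) — so ONE typed residual serves N ∪ V ∪ T;
  `cmRamifiedThreeBSD_of_indexLawAtThreeT` : **C1** via the landed glue (p547523).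
* §2 the same from the `ℤ₃`-level pair: `localThreeTorsionBSDThree_of_imcAll_of_indexLawThreeT`,
  `cmRamifiedThreeBSD_of_imcAll_of_indexLawThreeT_of_localKernelFinite` («zpthree-T»:
  C1 ⟸ 2 conjecture-defs ∧ 1 provable finiteness statement).
Nothing is asserted about (R-EU)₃ᵀ / (IMC)₃ᴬᴸᴸ / (PR|IMC)₃ᵀ (CONSTRUCTION / OPEN: not in print at `3`).

References: route file `Theses/PrintCFram.lean` rev ≥ 14 (items 20698, 20699, 20700, 20371);
`X12/O11/RamifiedStrictDescentAtThreeRegimeT{,Inputs,Discharge}.lean`, `X12/O11/RamifiedEllipticUnitMechanismZpThree{V,T}.lean`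
(ty2 gen 3); `PrintCfram/SplitPlaceTorsionThree.lean` (p554137), `PrintCfram/RegimeSplitThree.lean` (p547523);
HOME/PLAN.md v5 (δ); [cite: Miller2011LMS, §1 and Def. 1.1 (arXiv:1010.2431 p. 3) (`BSDp`)];
[cite: GreenbergLNM1716, §3 Lemmas 3.1–3.3 and §4 Prop. 4.13 (control and its two defects)];
[cite: Kolyvagin1990, Thm. A]; [cite: GrossZagier1986, Thm. I.(7.3)]; [cite: Cassels1965ArithmeticVIII].
-/

set_option autoImplicit false

noncomputable section

open scoped Classical

open WeierstrassCurve NumberField IsDedekindDomain Field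
  Literature.NumberTheory.EllipticCurves
  Literature.NumberTheory.EllipticCurves.Rank1Residual
  Literature.NumberTheory.GaloisRepresentations
  Summit.BirchSwinnertonDyer.Rank1Residual
  Summit.BirchSwinnertonDyer.Rank1Residual.X12.O11
  Summit.BirchSwinnertonDyer.BirchSwinnertonDyer.Theorems
  Summit.BirchSwinnertonDyer.BirchSwinnertonDyer.Theses.PrintCFram

namespace Summit.BirchSwinnertonDyer.Rank1Residual.PrintCfram

/-! ## §1 T, V, N and C1 BY NAME from the class-wide torsion-allowing law (R-EU)₃ᵀ -/

/-- **Regime T ⟸ class-wide (R-EU)₃ᵀ + the local-kernel finiteness obligation.** The route declaration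
`Theses.PrintCFram.LocalThreeTorsionBSDThree` (item stmt-BirchSwinnertonDyer-20699) BY NAME: at a
frame, `W.HasCM` and `CMRamified W 3` are `hF.1`, `hF.2.1`; companion VII-c's
`bsdp_three_of_indexLawAtThreeT_of_isFrameThree` (`T₀ = Σ(N⁺)`, mod-torsion generator levels and the
anticyclotomic tower built for the given frame, (R-ctrl)₃ᵀ♯ a theorem, (R-tors)₃ᵀ ⟸ GZK) gives
`BSDp W 3`; the item's `ℚ₃`-torsion witness binder is not used. CONDITIONAL on `hfin`, `hT3`; the type
of the conclusion is literally the route declaration; nothing booked.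
[cite: Miller2011LMS, §1 and Def. 1.1 (arXiv:1010.2431 p. 3)] -/
theorem localThreeTorsionBSDThree_of_indexLawAtThreeT
    (hfin : ∀ (W : WeierstrassCurve ℚ) [W.IsElliptic], LocalKernelFiniteAtThree W)
    (hT3 : ∀ (W : WeierstrassCurve ℚ) [W.IsElliptic] [W.IsGloballyMinimal],
      W.HasCM → W.analyticRank = 1 → CMRamified W 3 → RamifiedCMEllipticUnitIndexAtThreeT W) :
    Summit.BirchSwinnertonDyer.BirchSwinnertonDyer.Theses.PrintCFram.LocalThreeTorsionBSDThree :=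
  fun hmod hGZ hGZK hCassels W _ _ K _ _ 𝔭 W' _ _ C hF hr _ =>
    bsdp_three_of_indexLawAtThreeT_of_isFrameThree hmod hGZ hGZK hCassels hF hr
      (fun κ hκ => hfin W K 𝔭 W' C hF κ hκ) (hT3 W hF.1 hr hF.2.1)

/-- **Class-wide (R-EU)₃ᵀ ⟹ class-wide (R-EU)₃ᵛ** (companion VII-c's
`ramifiedCMEllipticUnitIndexAtThreeV_of_indexAtThreeT`, pointwise). [cite: GreenbergLNM1716, §3 Lemma 3.1] -/
theorem indexLawAtThreeV_of_indexLawAtThreeT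
    (hT3 : ∀ (W : WeierstrassCurve ℚ) [W.IsElliptic] [W.IsGloballyMinimal],
      W.HasCM → W.analyticRank = 1 → CMRamified W 3 → RamifiedCMEllipticUnitIndexAtThreeT W) :
    ∀ (W : WeierstrassCurve ℚ) [W.IsElliptic] [W.IsGloballyMinimal],
      W.HasCM → W.analyticRank = 1 → CMRamified W 3 → RamifiedCMEllipticUnitIndexAtThreeV W :=
  fun W _ _ hCM hr hram => ramifiedCMEllipticUnitIndexAtThreeV_of_indexAtThreeT (hT3 W hCM hr hram)

/-- **Regime V ⟸ class-wide (R-EU)₃ᵀ** (`Theses.PrintCFram.SplitPlaceTorsionBSDThree`, item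
stmt-BirchSwinnertonDyer-20700; p554137's edge after (R-EU)₃ᵀ ⟹ (R-EU)₃ᵛ): the finiteness obligation
is not needed here ((A𝔭)₃ makes `ker r_𝔭 = 0`). [cite: Miller2011LMS, §1 and Def. 1.1 (arXiv:1010.2431 p. 3)] -/
theorem splitPlaceTorsionBSDThree_of_indexLawAtThreeT
    (hT3 : ∀ (W : WeierstrassCurve ℚ) [W.IsElliptic] [W.IsGloballyMinimal],
      W.HasCM → W.analyticRank = 1 → CMRamified W 3 → RamifiedCMEllipticUnitIndexAtThreeT W) :
    Summit.BirchSwinnertonDyer.BirchSwinnertonDyer.Theses.PrintCFram.SplitPlaceTorsionBSDThree :=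
  splitPlaceTorsionBSDThree_of_indexLawAtThreeV (indexLawAtThreeV_of_indexLawAtThreeT hT3)

/-- **Regime N ⟸ class-wide (R-EU)₃ᵀ** (`Theses.PrintCFram.TorsionFreeFrameBSDThree`, item
stmt-BirchSwinnertonDyer-20698). [cite: Miller2011LMS, §1 and Def. 1.1 (arXiv:1010.2431 p. 3)] -/
theorem torsionFreeFrameBSDThree_of_indexLawAtThreeT
    (hT3 : ∀ (W : WeierstrassCurve ℚ) [W.IsElliptic] [W.IsGloballyMinimal],
      W.HasCM → W.analyticRank = 1 → CMRamified W 3 → RamifiedCMEllipticUnitIndexAtThreeT W) :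
    Summit.BirchSwinnertonDyer.BirchSwinnertonDyer.Theses.PrintCFram.TorsionFreeFrameBSDThree :=
  torsionFreeFrameBSDThree_of_indexLawAtThreeV (indexLawAtThreeV_of_indexLawAtThreeT hT3)

/-- **C1 ⟸ class-wide (R-EU)₃ᵀ + the local-kernel finiteness obligation**, BY NAME: the `@3` crux
`Theses.PrintCFram.CMRamifiedThreeBSD` from ONE torsion-allowing index law on all three regimes (N and
V through (R-EU)₃ᵀ ⟹ (R-EU)₃ᵛ, T through companion VII-c) and the glue of the tenure split
(`cmRamifiedThreeBSDOfRegimes_holds`, p547523). CONDITIONAL on both hypotheses; nothing booked.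
[cite: Miller2011LMS, §1 and Def. 1.1 (arXiv:1010.2431 p. 3)] -/
theorem cmRamifiedThreeBSD_of_indexLawAtThreeT
    (hfin : ∀ (W : WeierstrassCurve ℚ) [W.IsElliptic], LocalKernelFiniteAtThree W)
    (hT3 : ∀ (W : WeierstrassCurve ℚ) [W.IsElliptic] [W.IsGloballyMinimal],
      W.HasCM → W.analyticRank = 1 → CMRamified W 3 → RamifiedCMEllipticUnitIndexAtThreeT W) :
    Summit.BirchSwinnertonDyer.BirchSwinnertonDyer.Theses.PrintCFram.CMRamifiedThreeBSD :=
  cmRamifiedThreeBSDOfRegimes_holds (torsionFreeFrameBSDThree_of_indexLawAtThreeT hT3)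
    (localThreeTorsionBSDThree_of_indexLawAtThreeT hfin hT3)
    (splitPlaceTorsionBSDThree_of_indexLawAtThreeT hT3)

/-! ## §2 The same from the `ℤ₃`-level pair (IMC)₃ᴬᴸᴸ ∧ (PR|IMC)₃ᵀ («zpthree-T») -/

/-- **Class-wide (IMC)₃ᴬᴸᴸ ∧ class-wide (PR|IMC)₃ᵀ (under GZK) ⟹ class-wide (R-EU)₃ᵀ, GZK displayed**
(pointwise the seam `X12.O11.ramifiedCMEllipticUnitIndexAtThreeT_of_imcZpThreeAll_of_indexLawZpThreeT`).
[cite: Miller2011LMS, Def. 1.1] [cite: Kolyvagin1990, Thm. A] -/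
theorem indexLawAtThreeT_of_imcAll_of_indexLawThreeT
    (h1 : ∀ (W : WeierstrassCurve ℚ) [W.IsElliptic] [W.IsGloballyMinimal],
      W.HasCM → CMRamified W 3 → W.analyticRank = 1 → RamifiedCMEllipticUnitIMCAtZpThreeAll W)
    (h2 : rank_eq_analyticRank_of_analyticRank_le_one →
      ∀ (W : WeierstrassCurve ℚ) [W.IsElliptic] [W.IsGloballyMinimal],
      W.HasCM → CMRamified W 3 → W.analyticRank = 1 → RamifiedCMBottomClassIndexLawAtZpThreeT W)
    (hGZK : rank_eq_analyticRank_of_analyticRank_le_one) :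
    ∀ (W : WeierstrassCurve ℚ) [W.IsElliptic] [W.IsGloballyMinimal],
      W.HasCM → W.analyticRank = 1 → CMRamified W 3 → RamifiedCMEllipticUnitIndexAtThreeT W :=
  fun W _ _ hCM hr hram =>
    ramifiedCMEllipticUnitIndexAtThreeT_of_imcZpThreeAll_of_indexLawZpThreeT (h1 W hCM hram hr)
      (h2 hGZK W hCM hram hr)

/-- **Regime T ⟸ class-wide (IMC)₃ᴬᴸᴸ ∧ class-wide (PR|IMC)₃ᵀ + the finiteness obligation** (GZK is
the item's own third antecedent). [cite: Miller2011LMS, §1 and Def. 1.1 (arXiv:1010.2431 p. 3)] -/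
theorem localThreeTorsionBSDThree_of_imcAll_of_indexLawThreeT
    (hfin : ∀ (W : WeierstrassCurve ℚ) [W.IsElliptic], LocalKernelFiniteAtThree W)
    (h1 : ∀ (W : WeierstrassCurve ℚ) [W.IsElliptic] [W.IsGloballyMinimal],
      W.HasCM → CMRamified W 3 → W.analyticRank = 1 → RamifiedCMEllipticUnitIMCAtZpThreeAll W)
    (h2 : rank_eq_analyticRank_of_analyticRank_le_one →
      ∀ (W : WeierstrassCurve ℚ) [W.IsElliptic] [W.IsGloballyMinimal],
      W.HasCM → CMRamified W 3 → W.analyticRank = 1 → RamifiedCMBottomClassIndexLawAtZpThreeT W) :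
    Summit.BirchSwinnertonDyer.BirchSwinnertonDyer.Theses.PrintCFram.LocalThreeTorsionBSDThree :=
  fun hmod hGZ hGZK hCassels =>
    localThreeTorsionBSDThree_of_indexLawAtThreeT hfin
      (indexLawAtThreeT_of_imcAll_of_indexLawThreeT h1 h2 hGZK) hmod hGZ hGZK hCassels

/-- **C1 ⟸ class-wide (IMC)₃ᴬᴸᴸ ∧ class-wide (PR|IMC)₃ᵀ ∧ the local-kernel finiteness obligation**
(«zpthree-T»: the `@3` crux from TWO conjecture-grade `ℤ₃`-level statements and ONE provable
finiteness statement, all three regimes at once; GZK from each child's own antecedents). CONDITIONAL;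
nothing booked. [cite: Miller2011LMS, §1 and Def. 1.1 (arXiv:1010.2431 p. 3)] -/
theorem cmRamifiedThreeBSD_of_imcAll_of_indexLawThreeT_of_localKernelFinite
    (hfin : ∀ (W : WeierstrassCurve ℚ) [W.IsElliptic], LocalKernelFiniteAtThree W)
    (h1 : ∀ (W : WeierstrassCurve ℚ) [W.IsElliptic] [W.IsGloballyMinimal],
      W.HasCM → CMRamified W 3 → W.analyticRank = 1 → RamifiedCMEllipticUnitIMCAtZpThreeAll W)
    (h2 : rank_eq_analyticRank_of_analyticRank_le_one →
      ∀ (W : WeierstrassCurve ℚ) [W.IsElliptic] [W.IsGloballyMinimal],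
      W.HasCM → CMRamified W 3 → W.analyticRank = 1 → RamifiedCMBottomClassIndexLawAtZpThreeT W) :
    Summit.BirchSwinnertonDyer.BirchSwinnertonDyer.Theses.PrintCFram.CMRamifiedThreeBSD :=
  cmRamifiedThreeBSDOfRegimes_holds
    (fun hmod hGZ hGZK hCassels => torsionFreeFrameBSDThree_of_indexLawAtThreeT
      (indexLawAtThreeT_of_imcAll_of_indexLawThreeT h1 h2 hGZK) hmod hGZ hGZK hCassels)
    (localThreeTorsionBSDThree_of_imcAll_of_indexLawThreeT hfin h1 h2)
    (fun hmod hGZ hGZK hCassels => splitPlaceTorsionBSDThree_of_indexLawAtThreeT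
      (indexLawAtThreeT_of_imcAll_of_indexLawThreeT h1 h2 hGZK) hmod hGZ hGZK hCassels)

/-- **The `ℤ₃`-level pair at `3` also gives the N ∪ V pair class-wide** (weakenings of companion
`RamifiedEllipticUnitMechanismZpThreeT` §3), so «zpthree-NV» (`cmRamifiedThreeBSD_of_imcThreeV_of_indexLawThreeV_of_localThreeTorsion`)
is a special case of «zpthree-T». [cite: Miller2011LMS, Def. 1.1] -/
theorem imcThreeV_and_indexLawThreeV_of_imcAll_of_indexLawThreeT
    (h1 : ∀ (W : WeierstrassCurve ℚ) [W.IsElliptic] [W.IsGloballyMinimal],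
      W.HasCM → CMRamified W 3 → W.analyticRank = 1 → RamifiedCMEllipticUnitIMCAtZpThreeAll W)
    (h2 : rank_eq_analyticRank_of_analyticRank_le_one →
      ∀ (W : WeierstrassCurve ℚ) [W.IsElliptic] [W.IsGloballyMinimal],
      W.HasCM → CMRamified W 3 → W.analyticRank = 1 → RamifiedCMBottomClassIndexLawAtZpThreeT W) :
    (∀ (W : WeierstrassCurve ℚ) [W.IsElliptic] [W.IsGloballyMinimal],
      W.HasCM → CMRamified W 3 → W.analyticRank = 1 → RamifiedCMEllipticUnitIMCAtZpThreeV W) ∧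
    (rank_eq_analyticRank_of_analyticRank_le_one →
      ∀ (W : WeierstrassCurve ℚ) [W.IsElliptic] [W.IsGloballyMinimal],
      W.HasCM → CMRamified W 3 → W.analyticRank = 1 → RamifiedCMBottomClassIndexLawAtZpThreeV W) :=
  ⟨fun W _ _ hCM hram hr => ramifiedCMEllipticUnitIMCAtZpThreeV_of_imcAtZpThreeAll (h1 W hCM hram hr),
    fun hGZK W _ _ hCM hram hr =>
      ramifiedCMBottomClassIndexLawAtZpThreeV_of_indexLawAtZpThreeT (h2 hGZK W hCM hram hr)⟩

end Summit.BirchSwinnertonDyer.Rank1Residual.PrintCfram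

end
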